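import Summits.BirchSwinnertonDyer.Rank1Residual.Supersingular.LocalOddTorsionCountAt
import Summits.BirchSwinnertonDyer.Rank1Residual.Supersingular.PadicRootCensusNewton
import Summits.BirchSwinnertonDyer.Rank1Residual.GaloisImage.LocalThreeTorsionDeciderAt
import HarnessLib

/-!
# KERNEL DECIDER for the local torsion count `#E(ℚ_ℓ)[n]`, `n = 5, 7` (any odd prime `n` with its
# division polynomial as an integer list), at EVERY prime `ℓ`, from the integer `a`-invariants and a
# `decide`-checked certificate (cell `b2b-bsdres`, supersingular family, prover A = unit
# `b2b-bsdres-x10b`, gen 23; the odd-prime twin of n1011's `LocalThreeTorsionDeciderAt`)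

HONEST FRAMING (cell `b2b-bsdres`, run/shared/lean/b2b/bsd-rank1-residual/, verbatim in every
file): the goal of the cell is to DELETE the COMBINATION-SHAPED residual classes of the
Birch–Swinnerton-Dyer formula for ALL analytic-rank `≤ 1` elliptic curves over `ℚ` — "full BSD
formula for every rank `≤ 1` curve in class `C`" assembled STRICTLY from published theorems — so
that the rank-`≤ 1` remainder becomes exactly the CONSTRUCTION-SHAPED classes, which are TYPED
(missing-input `Prop`s), NOT attempted. This is not "finishing BSD". This file is a TOOL; nothing is
booked by it; no mark / label / count moved; X6 / X7 stay CONSTRUCTION-SHAPED. THEOREMS + small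
computable certificate-checker definitions (`Option ℕ` valued, no mathematical content); no named
fact, no `sorry`.

## What

* `torsionCheckAt (p : ℕ) (E₀ : WeierstrassCurve ℤ) (l : List ℤ) (k : ℕ) (cert) : Option ℕ` —
  EXACTLY n1011's `LocalTorsion3At.threeTorsionCheckAt` with `Ψ₃ ↦ l` and the DEEP census: the Hensel
  root census `RootCensusNewton.check₄ p` (child sieve mod `p` with the Newton digit + Taylor exclusion test at deep
  valuation, `Supersingular/PadicRootCensusSieve.lean` / `PadicRootCensusNewton.lean`) of the integer polynomial `ofList l` at
  precision `k` on the balls `(cᵢ, mᵢ, Nᵢ)` of `cert : List (ℤ × ℕ × ℕ × ℕ)`, plus per entry the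
  `g`-data `p^{wᵢ} ∥ g(cᵢ)` (`g = Ψ₂Sq = 4X³ + b₂X² + 2b₄X + b₆`, n1011's `Frob9.psi2sqL`) read at
  precision `wᵢ + δ_p + mᵢ ≤ Nᵢ` (`LocalTorsion3At.gEntryOKAt`, `sqFlagAt`); value `S` = number of
  entries whose `g(cᵢ)` is a square. `fiveTorsionCheckAt p a₁ … a₆ k cert` /
  `sevenTorsionCheckAt …` instantiate `l` with the exact lists `prePsi5Z` / `prePsi7Z` of
  `LocalOddTorsionCountAt` (`ofList_prePsi5Z : ofList (prePsi5Z E₀) = preΨ'₅(E₀)`).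
* **`natCard_torsion_padic_eq_of_check`** — for an ODD PRIME `n`, ANY prime `p`, integers
  `a₁, …, a₆` with `Δ ≠ 0`, a list `l` with `ofList l = preΨ'ₙ(⟨a₁,…,a₆⟩)` and
  `torsionCheckAt p ⟨a₁,…,a₆⟩ l k cert = some S`:
  `Nat.card {Q : ((⟨a₁,…,a₆⟩ : WeierstrassCurve ℚ).baseChange ℚ_[p]).toAffine.Point // n • Q = 0}
  = 1 + 2 * S`. Mathematics = n1011's T-LOC3L FILE L3 verbatim with `3 ↦ n`: the abscissae of
  `n`-torsion points are `p`-adic integers (`LocalOddTorsionCountAt`, AEC IV.3.2(b)/IV.6.1/VII.3.1 —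
  this is where `p = n` needs `n` odd), `nP = O ⟺ preΨ'ₙ(x) = 0` (AEC Ex. 3.7(f), PROVED in the tree),
  the roots of `preΨ'ₙ` in `ℤ_p` are exactly the certified Hensel roots (`RootCensusNewton.exists_roots_of_check₄`),
  and the fibre `{y}` over a root has `2` or `0` elements by the square class of `g` (n1011's
  `LocalTorsion3.natCard_fibre_eq_two / _zero`, `PadicSquareClass`, Serre *Cours d'arithmétique* II §3.3).
* `natCard_fiveTorsion_padic_eq_of_check`, `natCard_sevenTorsion_padic_eq_of_check` (`n = 5, 7`).
* Consumer: `Supersingular/LocalOddTorsionAdicCompletionAt.lean` reads these counts in the visibility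
  currency `Nat.card (nsmulAddMonoidHom 5 : (W.baseChange (v.adicCompletion ℚ)).toAffine.Point →+ _).ker`
  of the rank-0 offers `Supersingular/X6Visibility*`, `X7Visibility*`.

Certificates `(k, cert)` are FOUND outside the kernel (x10b gen 23 `code/oddtors_cert.py`, a Python
mirror of this checker) and CHECKED inside by `decide +kernel` only where a record invokes these
theorems. References: [SilvermanAEC2009] Ex. 3.7, IV.6.1, VII.3.1; [Serre1973] Ch. II §3.3; Hensel's
lemma (Mathlib); [CremonaMazur2000] §3 (the local conditions of visibility).
-/

set_option autoImplicit false

noncomputable section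

open scoped Classical
open Polynomial WeierstrassCurve
open Summit.BirchSwinnertonDyer.Rank1Residual.GaloisImage.RootCensus
open Summit.BirchSwinnertonDyer.Rank1Residual.GaloisImage.PadicSquareClass
open Summit.BirchSwinnertonDyer.Rank1Residual.Supersingular.RootCensusNewton (check₄ exists_roots_of_check₄)
open Summit.BirchSwinnertonDyer.Rank1Residual.GaloisImage.Frob9 (psi2sqL)
open Summit.BirchSwinnertonDyer.Rank1Residual.GaloisImage.LocalTorsion3
  (toRootEntry natCard_fibre_eq_two natCard_fibre_eq_zero finite_fibre)
open Summit.BirchSwinnertonDyer.Rank1Residual.GaloisImage.LocalTorsion3At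
  (sqPrecAt sqFlagAt gEntryOKAt one_le_sqPrecAt sqPrecAt_eq_three_of_eq_two
    isSquare_intCast_padic_iff_sqFlagAt)

namespace Summit.BirchSwinnertonDyer.Rank1Residual.Supersingular.LocalOddTorsion

/-! ### The checker -/

/-- **The checker at `p` for the division polynomial list `l`.** `some S` iff the root census
(`check₄ p`) of `ofList l` succeeds at precision `k` on the balls of `cert` and every entry's `g`-data
checks (`g = psi2sqL E₀`); `S` = number of entries with a square `g`. [folklore] -/
def torsionCheckAt (p : ℕ) (E₀ : WeierstrassCurve ℤ) (l : List ℤ) (k : ℕ)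
    (cert : List (ℤ × ℕ × ℕ × ℕ)) : Option ℕ :=
  if check₄ p l k (cert.map toRootEntry) && cert.all (gEntryOKAt p (psi2sqL E₀))
  then some (cert.countP fun e => sqFlagAt p (evalList (psi2sqL E₀) e.1) e.2.2.2)
  else none

/-- **The `5`-torsion checker at `p`** on the integer equation `⟨a₁, a₂, a₃, a₄, a₆⟩`: `torsionCheckAt`
with the exact list `prePsi5Z` of `preΨ'₅`. [folklore] -/
def fiveTorsionCheckAt (p : ℕ) (a₁ a₂ a₃ a₄ a₆ : ℤ) (k : ℕ) (cert : List (ℤ × ℕ × ℕ × ℕ)) :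
    Option ℕ :=
  torsionCheckAt p ⟨a₁, a₂, a₃, a₄, a₆⟩ (prePsi5Z ⟨a₁, a₂, a₃, a₄, a₆⟩) k cert

/-- **The `7`-torsion checker at `p`** on `⟨a₁, a₂, a₃, a₄, a₆⟩`: `torsionCheckAt` with the exact list
`prePsi7Z` of `preΨ'₇`. [folklore] -/
def sevenTorsionCheckAt (p : ℕ) (a₁ a₂ a₃ a₄ a₆ : ℤ) (k : ℕ) (cert : List (ℤ × ℕ × ℕ × ℕ)) :
    Option ℕ :=
  torsionCheckAt p ⟨a₁, a₂, a₃, a₄, a₆⟩ (prePsi7Z ⟨a₁, a₂, a₃, a₄, a₆⟩) k cert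

/-! ### The decider theorem -/

section Main

variable (p : ℕ) [hp : Fact p.Prime] (a₁ a₂ a₃ a₄ a₆ : ℤ)

/-- The curve over `ℚ_p`. -/
private abbrev Ep : WeierstrassCurve ℚ_[p] :=
  ((⟨a₁, a₂, a₃, a₄, a₆⟩ : WeierstrassCurve ℚ).baseChange ℚ_[p])

/-- The curve over `ℚ_p` is the integer equation read along `ℤ → ℚ_p`. -/
private theorem Ep_eq_map : Ep p a₁ a₂ a₃ a₄ a₆ =
    (⟨a₁, a₂, a₃, a₄, a₆⟩ : WeierstrassCurve ℤ).map (algebraMap ℤ ℚ_[p]) := by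
  ext <;> simp [Ep, WeierstrassCurve.baseChange, WeierstrassCurve.map]

/-- The curve over `ℚ_p` has `p`-integral coefficients. -/
private instance Ep_isIntegral : (Ep p a₁ a₂ a₃ a₄ a₆).IsIntegral ℤ_[p] := by
  rw [Ep_eq_map]
  exact ⟨⟨(a₁ : ℤ_[p]), (a₂ : ℤ_[p]), (a₃ : ℤ_[p]), (a₄ : ℤ_[p]), (a₆ : ℤ_[p])⟩,
    by ext <;> simp [WeierstrassCurve.baseChange, WeierstrassCurve.map]⟩

/-- The discriminant over `ℚ_p` is the cast of the integer discriminant. -/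
private theorem Ep_Δ : (Ep p a₁ a₂ a₃ a₄ a₆).Δ =
    (((⟨a₁, a₂, a₃, a₄, a₆⟩ : WeierstrassCurve ℤ).Δ : ℤ) : ℚ_[p]) := by
  rw [Ep_eq_map, WeierstrassCurve.map_Δ]; simp

/-- `preΨ'ₙ` of the curve, evaluated at a `p`-adic integer, is the integer list polynomial `l`. -/
private theorem eval_preΨ'_eq_aeval {n : ℕ} {l : List ℤ}
    (hl : ofList l = (⟨a₁, a₂, a₃, a₄, a₆⟩ : WeierstrassCurve ℤ).preΨ' n) (z : ℤ_[p]) :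
    ((Ep p a₁ a₂ a₃ a₄ a₆).preΨ' n).eval (z : ℚ_[p]) = ((aeval z (ofList l) : ℤ_[p]) : ℚ_[p]) := by
  rw [coe_aeval_ofList, aeval_ofList_eq_eval_preΨ' hl, Ep_eq_map]

/-- `g = 4x³ + b₂x² + 2b₄x + b₆` of the curve, evaluated at a `p`-adic integer, is the integer list
polynomial `psi2sqL`. -/
private theorem g_eq_aeval (z : ℤ_[p]) :
    4 * (z : ℚ_[p]) ^ 3 + (Ep p a₁ a₂ a₃ a₄ a₆).b₂ * (z : ℚ_[p]) ^ 2 +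
        2 * (Ep p a₁ a₂ a₃ a₄ a₆).b₄ * (z : ℚ_[p]) + (Ep p a₁ a₂ a₃ a₄ a₆).b₆ =
      ((aeval z (ofList (psi2sqL ⟨a₁, a₂, a₃, a₄, a₆⟩)) : ℤ_[p]) : ℚ_[p]) := by
  rw [coe_aeval_ofList, aeval_ofList_psi2sqL, Ep_eq_map]

/-- `(l.map f)`-sums over `Fin l.length`. [folklore] -/
private theorem sum_fin_eq_sum_map {α : Type*} (l : List α) (f : α → ℕ) :
    ∑ i : Fin l.length, f (l.get i) = (l.map f).sum := by
  rw [← List.sum_ofFn]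
  congr 1
  rw [show (fun i => f (l.get i)) = f ∘ l.get from rfl, ← List.map_ofFn, List.ofFn_get]

/-- `Σ (if b then 2 else 0) = 2 · countP`. [folklore] -/
private theorem sum_map_ite_eq_two_mul_countP {α : Type*} (l : List α) (P : α → Bool) :
    (l.map fun a => if P a then 2 else 0).sum = 2 * l.countP P := by
  induction l with
  | nil => simp
  | cons a l ih =>
    simp only [List.map_cons, List.sum_cons, ih, List.countP_cons]
    by_cases h : P a <;> simp [h]; ring

/-- **THE DECIDER.** For an odd prime `n`, any prime `p`, an integer equation `⟨a₁, …, a₆⟩` with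
`Δ ≠ 0`, an integer list `l` with `ofList l = preΨ'ₙ`, and `torsionCheckAt p ⟨a₁,…,a₆⟩ l k cert =
some S`: the number of `ℚ_p`-rational points `Q` of `E : y² + a₁xy + a₃y = x³ + a₂x² + a₄x + a₆`
with `nQ = O` is `1 + 2S`. [folklore] -/
theorem natCard_torsion_padic_eq_of_check {n : ℕ} (hn : n.Prime) (hn2 : n ≠ 2)
    (hΔ : (⟨a₁, a₂, a₃, a₄, a₆⟩ : WeierstrassCurve ℤ).Δ ≠ 0) {l : List ℤ}
    (hl : ofList l = (⟨a₁, a₂, a₃, a₄, a₆⟩ : WeierstrassCurve ℤ).preΨ' n) {k S : ℕ}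
    {cert : List (ℤ × ℕ × ℕ × ℕ)} (h : torsionCheckAt p ⟨a₁, a₂, a₃, a₄, a₆⟩ l k cert = some S) :
    Nat.card {Q : ((⟨a₁, a₂, a₃, a₄, a₆⟩ : WeierstrassCurve ℚ).baseChange ℚ_[p]).toAffine.Point //
      n • Q = 0} = 1 + 2 * S := by
  -- unpack the checker
  unfold torsionCheckAt at h
  split_ifs at h with hc
  simp only [Option.some.injEq] at h
  rw [Bool.and_eq_true, List.all_eq_true] at hc
  obtain ⟨hcheck, hg⟩ := hc
  subst h
  have hodd : ¬ Even n := not_even_of_prime_ne_two hn hn2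
  -- real-number facts about `p`
  have hp1 : (1 : ℝ) < p := by exact_mod_cast hp.out.one_lt
  have hp0 : (0 : ℝ) < p := by positivity
  have hpR : (p : ℝ) ≠ 0 := hp0.ne'
  -- the curve
  set E := Ep p a₁ a₂ a₃ a₄ a₆ with hEdef
  change Nat.card {Q : E.toAffine.Point // n • Q = 0} = _
  haveI : E.IsElliptic := by
    refine ⟨isUnit_iff_ne_zero.mpr ?_⟩
    rw [hEdef, Ep_Δ]; exact_mod_cast hΔ
  have h2 : (2 : ℚ_[p]) ≠ 0 := two_ne_zero
  -- the roots of `preΨ'ₙ` in `ℤ_p`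
  set lg := psi2sqL (⟨a₁, a₂, a₃, a₄, a₆⟩ : WeierstrassCurve ℤ) with hlg
  set rc := cert.map toRootEntry with hrc
  obtain ⟨ρ, hinj, hρ, hcomplete⟩ := exists_roots_of_check₄ (p := p) l k rc hcheck
  have hlen : rc.length = cert.length := by rw [hrc, List.length_map]
  have hget : ∀ i : Fin rc.length, rc.get i = toRootEntry (cert.get (Fin.cast hlen i)) := by
    intro i; simp [hrc, List.getElem_map, Fin.cast]
  -- Step 1: torsion points ↔ (x, y) with `E(x,y)` and `preΨ'ₙ(x) = 0`
  let S' := {xy : ℚ_[p] × ℚ_[p] // E.toAffine.Equation xy.1 xy.2 ∧ (E.preΨ' n).eval xy.1 = 0}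
  have e1 : {Q : E.toAffine.Point // n • Q = 0} ≃ WithZero S' := by
    refine (Affine.nonsingularPointEquivSubtype (p := fun Q => n • Q = 0)
      (show n • (0 : E.toAffine.Point) = 0 from nsmul_zero n)).trans
      (Equiv.optionCongr (Equiv.subtypeEquivRight fun xy => ?_))
    constructor
    · rintro ⟨hns, hnQ⟩
      exact ⟨hns.left, (nsmul_some_eq_zero_iff_eval_preΨ' E hodd hns).mp hnQ⟩
    · rintro ⟨heq, hΨ⟩
      have hns : E.toAffine.Nonsingular xy.1 xy.2 := (Affine.equation_iff_nonsingular).mp heq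
      exact ⟨hns, (nsmul_some_eq_zero_iff_eval_preΨ' E hodd hns).mpr hΨ⟩
  -- Step 2: `S' ≃ Σ i, {y // E(ρ i, y)}` (the `x`-coordinates are integral)
  have hxint : ∀ s : S', ‖s.1.1‖ ≤ 1 := by
    rintro ⟨⟨x, y⟩, heq, hΨ⟩
    exact norm_le_one_of_equation_of_eval_preΨ' E hn hn2 heq hΨ
  have hroot : ∀ s : S', ∃ i, ((ρ i : ℤ_[p]) : ℚ_[p]) = s.1.1 := by
    intro s
    set zs : ℤ_[p] := ⟨s.1.1, hxint s⟩ with hzs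
    have hzs' : (zs : ℚ_[p]) = s.1.1 := rfl
    obtain ⟨i, hi⟩ := hcomplete zs (by
      have h1 := eval_preΨ'_eq_aeval p a₁ a₂ a₃ a₄ a₆ hl zs
      rw [← hEdef, hzs'] at h1
      have : ((aeval zs (ofList l) : ℤ_[p]) : ℚ_[p]) = 0 := by rw [← h1]; exact s.2.2
      exact PadicInt.coe_eq_zero.mp this)
    exact ⟨i, by rw [hi]⟩
  have hρroot : ∀ i, (E.preΨ' n).eval ((ρ i : ℤ_[p]) : ℚ_[p]) = 0 := by
    intro i; rw [hEdef, eval_preΨ'_eq_aeval p a₁ a₂ a₃ a₄ a₆ hl, (hρ i).1]; rfl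
  let F : Fin rc.length → Type :=
    fun i => {y : ℚ_[p] // E.toAffine.Equation ((ρ i : ℤ_[p]) : ℚ_[p]) y}
  have e2 : S' ≃ Σ i, F i :=
    { toFun := fun s => ⟨Classical.choose (hroot s), ⟨s.1.2, by
        rw [Classical.choose_spec (hroot s)]; exact s.2.1⟩⟩
      invFun := fun s => ⟨(((ρ s.1 : ℤ_[p]) : ℚ_[p]), s.2.1), s.2.2, hρroot s.1⟩
      left_inv := by
        rintro ⟨⟨x, y⟩, heq, hΨ⟩
        have := Classical.choose_spec (hroot ⟨⟨x, y⟩, heq, hΨ⟩)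
        apply Subtype.ext; apply Prod.ext
        · exact this
        · rfl
      right_inv := by
        rintro ⟨i, y, hy⟩
        have hspec := Classical.choose_spec (hroot ⟨(((ρ i : ℤ_[p]) : ℚ_[p]), y), hy, hρroot i⟩)
        have hi : Classical.choose (hroot ⟨(((ρ i : ℤ_[p]) : ℚ_[p]), y), hy, hρroot i⟩) = i :=
          hinj (Subtype.ext hspec)
        exact Sigma.subtype_ext hi rfl }
  -- Step 3: per-index fibre counts from the square class of `g`
  have hfib : ∀ i : Fin rc.length, Nat.card (F i) =
      if sqFlagAt p (evalList lg (cert.get (Fin.cast hlen i)).1) (cert.get (Fin.cast hlen i)).2.2.2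
      then 2 else 0 := by
    intro i
    have hprec := (hρ i).2.2
    rw [hget i] at hprec
    simp only [toRootEntry] at hprec
    set e := cert.get (Fin.cast hlen i) with he
    obtain ⟨hw, hw', hN⟩ : (p : ℤ) ^ e.2.2.2 ∣ evalList lg e.1 ∧
        ¬ (p : ℤ) ^ (e.2.2.2 + 1) ∣ evalList lg e.1 ∧ e.2.2.2 + sqPrecAt p + e.2.1 ≤ e.2.2.1 := by
      have := hg e (List.get_mem cert _)
      simp only [gEntryOKAt, Bool.and_eq_true, beq_iff_eq, Bool.not_eq_true', beq_eq_false_iff_ne,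
        ne_eq, emod_eq_zero_iff_dvd', decide_eq_true_eq] at this
      exact ⟨this.1.1, this.1.2, this.2⟩
    set z := ρ i with hz
    set gc : ℤ := evalList lg e.1 with hgc
    have hgc0 : (gc : ℚ_[p]) ≠ 0 := by
      have : gc ≠ 0 := by rintro h0; rw [h0] at hw'; exact hw' (dvd_zero _)
      exact_mod_cast this
    have hgcn : ‖(gc : ℚ_[p])‖ = (p : ℝ) ^ (-(e.2.2.2 : ℤ)) := norm_intCast_padic_eq hw hw'
    have hG := g_eq_aeval p a₁ a₂ a₃ a₄ a₆ z
    rw [← hEdef] at hG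
    -- `‖g(z) - g(c)‖ ≤ ‖z - c‖ ≤ p^{-(N - m)} ≤ p^{-(w+δ)} = p^{-δ} ‖g(c)‖`
    have hdist : ‖((aeval z (ofList lg) : ℤ_[p]) : ℚ_[p]) - (gc : ℚ_[p])‖ ≤
        (p : ℝ) ^ (-(sqPrecAt p : ℤ)) * ‖(gc : ℚ_[p])‖ := by
      have h1 := padic_polynomial_dist (ofList lg) z (e.1 : ℤ_[p])
      rw [aeval_intCast_ofList] at h1
      rw [hgcn, ← PadicInt.coe_intCast, ← PadicInt.coe_sub, ← PadicInt.norm_def]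
      refine (h1.trans hprec).trans ?_
      rw [← zpow_add₀ hpR]
      have hmN : e.2.1 ≤ e.2.2.1 := by omega
      exact zpow_le_zpow_right₀ hp1.le (by push_cast [Nat.cast_sub hmN]; omega)
    obtain ⟨hG0, hGsq⟩ := isSquare_iff_of_norm_sub_le (one_le_sqPrecAt p)
      (fun h => sqPrecAt_eq_three_of_eq_two h) hgc0 hdist
    have hsq := isSquare_intCast_padic_iff_sqFlagAt (p := p) gc e.2.2.2 hw hw'
    by_cases hflag : sqFlagAt p gc e.2.2.2 = true
    · rw [if_pos hflag]
      have : IsSquare (gc : ℚ_[p]) := hsq.mpr hflag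
      refine natCard_fibre_eq_two E h2 _ ?_ ?_
      · rw [hG]; exact hGsq.mpr this
      · rw [hG]; exact hG0
    · rw [if_neg hflag]
      have : ¬ IsSquare (gc : ℚ_[p]) := fun hs => hflag (hsq.mp hs)
      refine natCard_fibre_eq_zero E h2 _ ?_
      rw [hG]; exact fun hs => this (hGsq.mp hs)
  -- Step 4: count
  haveI : ∀ i, Finite (F i) := fun i => finite_fibre E h2 _
  haveI : Finite S' := Finite.of_equiv _ e2.symm
  haveI : Fintype S' := Fintype.ofFinite S'
  rw [Nat.card_congr e1, show Nat.card (WithZero S') = Nat.card (Option S') from rfl,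
    Nat.card_eq_fintype_card, Fintype.card_option, ← Nat.card_eq_fintype_card, Nat.card_congr e2,
    Nat.card_sigma, add_comm]
  congr 1
  let f : ℤ × ℕ × ℕ × ℕ → ℕ := fun e => if sqFlagAt p (evalList lg e.1) e.2.2.2 then 2 else 0
  calc ∑ i, Nat.card (F i) = ∑ i : Fin rc.length, f (cert.get (Fin.cast hlen i)) :=
        Finset.sum_congr rfl fun i _ => hfib i
    _ = ∑ i : Fin cert.length, f (cert.get i) :=
        Fintype.sum_equiv (finCongr hlen) _ _ (fun i => rfl)
    _ = (cert.map f).sum := sum_fin_eq_sum_map cert f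
    _ = 2 * cert.countP (fun e => sqFlagAt p (evalList lg e.1) e.2.2.2) :=
        sum_map_ite_eq_two_mul_countP cert _

/-- **The decider at `n = 5`**: `fiveTorsionCheckAt p a₁ … a₆ k cert = some S` and `Δ ≠ 0` give
`#E(ℚ_p)[5] = 1 + 2S` (any prime `p`, also `p = 5` and `p = 2`). [folklore] -/
theorem natCard_fiveTorsion_padic_eq_of_check
    (hΔ : (⟨a₁, a₂, a₃, a₄, a₆⟩ : WeierstrassCurve ℤ).Δ ≠ 0) {k S : ℕ}
    {cert : List (ℤ × ℕ × ℕ × ℕ)} (h : fiveTorsionCheckAt p a₁ a₂ a₃ a₄ a₆ k cert = some S) :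
    Nat.card {Q : ((⟨a₁, a₂, a₃, a₄, a₆⟩ : WeierstrassCurve ℚ).baseChange ℚ_[p]).toAffine.Point //
      (5 : ℕ) • Q = 0} = 1 + 2 * S :=
  natCard_torsion_padic_eq_of_check p a₁ a₂ a₃ a₄ a₆ (by norm_num) (by norm_num) hΔ ofList_prePsi5Z h

/-- **The decider at `n = 7`**: `sevenTorsionCheckAt p a₁ … a₆ k cert = some S` and `Δ ≠ 0` give
`#E(ℚ_p)[7] = 1 + 2S` (any prime `p`). [folklore] -/
theorem natCard_sevenTorsion_padic_eq_of_check
    (hΔ : (⟨a₁, a₂, a₃, a₄, a₆⟩ : WeierstrassCurve ℤ).Δ ≠ 0) {k S : ℕ}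
    {cert : List (ℤ × ℕ × ℕ × ℕ)} (h : sevenTorsionCheckAt p a₁ a₂ a₃ a₄ a₆ k cert = some S) :
    Nat.card {Q : ((⟨a₁, a₂, a₃, a₄, a₆⟩ : WeierstrassCurve ℚ).baseChange ℚ_[p]).toAffine.Point //
      (7 : ℕ) • Q = 0} = 1 + 2 * S :=
  natCard_torsion_padic_eq_of_check p a₁ a₂ a₃ a₄ a₆ (by norm_num) (by norm_num) hΔ ofList_prePsi7Z h

end Main


end Summit.BirchSwinnertonDyer.Rank1Residual.Supersingular.LocalOddTorsion

end
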